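import Mathlib
import HarnessLib
import Summits.ValiantsHypothesis.ValiantsHypothesis.Theorems.LacunarySymmetroidMatrixDescartesProductPlusOneOneRiser
import Summits.ValiantsHypothesis.ValiantsHypothesis.Theorems.LacunarySymmetroidMatrixDescartesProductPlusOneCloudMonotone

/-!
# LINE (A) `product_plus_one` — the first gap of every incoherent member carries at most three zeros (LINE currency, K = 3)

Crux item stmt-ValiantsHypothesis-18050, LINE (A) floor structure (registered floor stub `OneChangeFloorK3`; memo
`pub/val-lit/lmr/NOTE-p7g15-18050-LINEA-incoherent-cell.md` §11).  Support `d 0 < d 1 < d 2`, rows `a : Fin m → Fin 3 → ℝ`, bottom coupling,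
`R = eulerNumerator d a 0` (written out).  ONE riser row `j₀` with `a_{j₀1} < 0`, `a_{j₀2} < 0` (bottom letter free), every other row an
incoherent puller `a_{j0} > 0`, `a_{j1} ≤ 0`, `a_{j2} ≤ 0`, not a bottom monomial (`a_{j1} + a_{j2} < 0`).

* `puller_trinomial_eulerRatio_eq` — such a row's Euler ratio is `−rowPsi0 e₁ e₂ a_{j0} (−a_{j1}) (−a_{j2}) x` (✓ `…CloudDefs`);
* `oneRiser_trinomial_eulerSum_eq` — `Σ_j Φ_j(x) = P(x)/(b x^p + c x^q − a_{j₀0}) − cloudP0 … x` over `univ.erase j₀` with weights `1`;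
* `oneSigned_trinomialCloud_eulerNumerator_no_four_zeros` — the same for one ONE-SIGNED row `(−,−,−)` on `(0, x₄]`;
* ★★ `oneRiser_trinomialCloud_eulerNumerator_no_four_zeros` — on `[x₁, x₄] ⊂ (0,∞)` where the riser is switched (`f_{j₀} < 0`) and every
  puller unswitched at `x₄`, `R` does not vanish at four points `x₁ < x₂ < x₃ < x₄` (✓ `oneRiser_no_four_zeros_trinomialCloud`).  In particular the
  FIRST GAP `(t₀, t₁)` of every member all of whose rows are incoherent one-change trinomials/binomials carries at most three zeros of `R` — for
  every ratio, every `m`, all coefficients.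

Honest framing: a located STRUCTURE theorem of the research floor (one switched row); several switched rows (the budget law), coherent or one-signed
pullers, and the global count are untouched; NOT `OneChangeFloorK3` / `stub_classRowK3` / `stub_polyLaw` / `MatrixDescartes` / B; `VP ≠ VNP` NOT
proved.  No definitions, no named facts; Mathlib only.
-/

set_option linter.dupNamespace false

namespace Summit.ValiantsHypothesis.ValiantsHypothesis.Theorems.LacunarySymmetroidMatrixDescartes

namespace ProductPlusOne

open Finset Polynomial
open scoped BigOperators Polynomial

/-- An incoherent puller's Euler ratio through `rowPsi0`: `(p a₁ x^{d₀+p} + q a₂ x^{d₀+q})/(a₀x^{d₀} + a₁x^{d₀+p} + a₂x^{d₀+q})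
 = −rowPsi0 e₁ e₂ a₀ (−a₁) (−a₂) x` (`x > 0`, row non-vanishing). -/
theorem puller_trinomial_eulerRatio_eq (e₁ e₂ d0 : ℕ) (a0 a1 a2 : ℝ) {x : ℝ} (hx : 0 < x)
    (hF : a0 + a1 * x ^ (e₁ + 1) + a2 * x ^ (e₁ + e₂ + 2) ≠ 0) :
    (((e₁ : ℝ) + 1) * a1 * x ^ (d0 + (e₁ + 1)) + ((e₁ : ℝ) + e₂ + 2) * a2 * x ^ (d0 + (e₁ + e₂ + 2)))
        / (a0 * x ^ d0 + a1 * x ^ (d0 + (e₁ + 1)) + a2 * x ^ (d0 + (e₁ + e₂ + 2)))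
      = -rowPsi0 e₁ e₂ a0 (-a1) (-a2) x := by
  unfold rowPsi0 rowH rowU
  have hxd : x ^ d0 ≠ 0 := pow_ne_zero _ hx.ne'
  have e : a0 - -a1 * x ^ (e₁ + 1) - -a2 * x ^ (e₁ + e₂ + 2) = a0 + a1 * x ^ (e₁ + 1) + a2 * x ^ (e₁ + e₂ + 2) := by ring
  rw [e, pow_one, pow_one]
  have hden : a0 * x ^ d0 + a1 * x ^ (d0 + (e₁ + 1)) + a2 * x ^ (d0 + (e₁ + e₂ + 2)) ≠ 0 := by
    have : a0 * x ^ d0 + a1 * x ^ (d0 + (e₁ + 1)) + a2 * x ^ (d0 + (e₁ + e₂ + 2))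
        = x ^ d0 * (a0 + a1 * x ^ (e₁ + 1) + a2 * x ^ (e₁ + e₂ + 2)) := by ring
    rw [this]; exact mul_ne_zero hxd hF
  rw [div_eq_iff hden]
  field_simp
  ring

/-- **Total Euler ratio of a one-riser incoherent member** on an interval where the riser is negative and the pullers positive:
`Σ_j Φ_j(x) = P(x)/(b x^p + c x^q − a_{j₀0}) − cloudP0 e₁ e₂ (univ.erase j₀) 1 (a·0) (−a·1) (−a·2) x` (`b = −a_{j₀1}`, `c = −a_{j₀2}`). -/
theorem oneRiser_trinomial_eulerSum_eq {m : ℕ} (d : Fin 3 → ℕ) (e₁ e₂ : ℕ) (he₁ : d 1 = d 0 + e₁ + 1) (he₂ : d 2 = d 1 + e₂ + 1)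
    (a : Fin m → Fin 3 → ℝ) (j₀ : Fin m) {x : ℝ} (hx : 0 < x)
    (hr : a j₀ 0 + a j₀ 1 * x ^ (e₁ + 1) + a j₀ 2 * x ^ (e₁ + e₂ + 2) ≠ 0)
    (hp : ∀ j, j ≠ j₀ → a j 0 + a j 1 * x ^ (e₁ + 1) + a j 2 * x ^ (e₁ + e₂ + 2) ≠ 0) :
    ∑ j, (X * derivative (∑ l, C (a j l) * X ^ (d l) : ℝ[X]) - C ((d 0 : ℕ) : ℝ) * ∑ l, C (a j l) * X ^ (d l)).eval x
        / (∑ l, C (a j l) * X ^ (d l) : ℝ[X]).eval x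
      = (((e₁ : ℝ) + 1) * (-(a j₀ 1)) * x ^ (e₁ + 1) + ((e₁ : ℝ) + e₂ + 2) * (-(a j₀ 2)) * x ^ (e₁ + e₂ + 2))
            / ((-(a j₀ 1)) * x ^ (e₁ + 1) + (-(a j₀ 2)) * x ^ (e₁ + e₂ + 2) - a j₀ 0)
          - cloudP0 e₁ e₂ (Finset.univ.erase j₀) (fun _ => (1 : ℝ)) (fun j => a j 0) (fun j => -(a j 1)) (fun j => -(a j 2)) x := by
  classical
  have hd := fin3_support_eq_gaps d e₁ e₂ he₁ he₂
  have hev : ∀ j, (∑ l, C (a j l) * X ^ (d l) : ℝ[X]).eval x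
        = a j 0 * x ^ (d 0) + a j 1 * x ^ (d 0 + (e₁ + 1)) + a j 2 * x ^ (d 0 + (e₁ + e₂ + 2)) ∧
      (X * derivative (∑ l, C (a j l) * X ^ (d l) : ℝ[X]) - C ((d 0 : ℕ) : ℝ) * ∑ l, C (a j l) * X ^ (d l)).eval x
        = ((e₁ + 1 : ℕ) : ℝ) * a j 1 * x ^ (d 0 + (e₁ + 1)) + ((e₁ + e₂ + 2 : ℕ) : ℝ) * a j 2 * x ^ (d 0 + (e₁ + e₂ + 2)) := by
    intro j
    have h := eval_trinomial_three (d 0) (e₁ + 1) (e₁ + e₂ + 2) (a j) x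
    rw [hd] at h
    exact h
  rw [← Finset.add_sum_erase _ _ (Finset.mem_univ j₀)]
  unfold cloudP0
  conv_rhs => rw [sub_eq_add_neg, ← Finset.sum_neg_distrib]
  congr 1
  · rw [(hev j₀).1, (hev j₀).2, riser_eulerRatio_eq (d 0) (e₁ + 1) (e₁ + e₂ + 2) _ _ (a j₀ 0) (a j₀ 1) (a j₀ 2) hx hr]
    push_cast
    ring_nf
  · refine Finset.sum_congr rfl fun j hj => ?_
    have hj' : j ≠ j₀ := Finset.ne_of_mem_erase hj
    rw [(hev j).1, (hev j).2]
    push_cast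
    rw [puller_trinomial_eulerRatio_eq e₁ e₂ (d 0) (a j 0) (a j 1) (a j 2) hx (hp j hj')]
    simp only [one_mul]

/-- ★★ **ONE-RISER INTERACTION LEMMA vs ANY INCOHERENT CLOUD, LINE currency (K = 3, bottom coupling).**  Support `d 0 < d 1 < d 2`; riser row
`j₀` with `a_{j₀1} < 0`, `a_{j₀2} < 0`; every other row an incoherent puller (`a_{j0} > 0`, `a_{j1} ≤ 0`, `a_{j2} ≤ 0`, `a_{j1} + a_{j2} < 0`).
On `[x₁, x₄] ⊂ (0,∞)` where the riser is switched (`f_{j₀} < 0`) and every puller unswitched at `x₄` (`f_j(x₄) > 0`), the c-free Euler numerator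
`eulerNumerator d a 0` does not vanish at four points `x₁ < x₂ < x₃ < x₄`. [this file's theorem] -/
theorem oneRiser_trinomialCloud_eulerNumerator_no_four_zeros {m : ℕ} (d : Fin 3 → ℕ) (h01 : d 0 < d 1) (h12 : d 1 < d 2)
    (a : Fin m → Fin 3 → ℝ) (j₀ : Fin m) (hr1 : a j₀ 1 < 0) (hr2 : a j₀ 2 < 0)
    (hpul : ∀ j, j ≠ j₀ → 0 < a j 0 ∧ a j 1 ≤ 0 ∧ a j 2 ≤ 0 ∧ a j 1 + a j 2 < 0)
    {x₁ x₂ x₃ x₄ : ℝ} (h0 : 0 < x₁) (h12' : x₁ < x₂) (h23 : x₂ < x₃) (h34 : x₃ < x₄)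
    (hsw : ∀ x ∈ Set.Icc x₁ x₄, (∑ l, C (a j₀ l) * X ^ (d l) : ℝ[X]).eval x < 0)
    (hun : ∀ j, j ≠ j₀ → 0 < (∑ l, C (a j l) * X ^ (d l) : ℝ[X]).eval x₄)
    (hzero : ∀ x ∈ ({x₁, x₂, x₃, x₄} : Set ℝ),
      (∑ j, (∑ l, C (a j l * ((d l : ℝ) - d 0)) * X ^ (d l)) * ∏ i ∈ Finset.univ.erase j, (∑ l, C (a i l) * X ^ (d l))
        : ℝ[X]).eval x = 0) : False := by
  classical
  obtain ⟨e₁, he₁⟩ := Nat.exists_eq_add_of_lt h01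
  obtain ⟨e₂, he₂⟩ := Nat.exists_eq_add_of_lt h12
  have hd := fin3_support_eq_gaps d e₁ e₂ he₁ he₂
  have hev : ∀ j x, (∑ l, C (a j l) * X ^ (d l) : ℝ[X]).eval x
        = a j 0 * x ^ (d 0) + a j 1 * x ^ (d 0 + (e₁ + 1)) + a j 2 * x ^ (d 0 + (e₁ + e₂ + 2)) := by
    intro j x
    have h := (eval_trinomial_three (d 0) (e₁ + 1) (e₁ + e₂ + 2) (a j) x).1
    rw [hd] at h
    exact h
  have h14 : x₁ < x₄ := by linarith
  have hIcc : ∀ x ∈ ({x₁, x₂, x₃, x₄} : Set ℝ), x ∈ Set.Icc x₁ x₄ := by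
    intro x hx
    simp only [Set.mem_insert_iff, Set.mem_singleton_iff] at hx
    rcases hx with h | h | h | h <;> (subst h; constructor <;> linarith)
  -- riser switched on the interval (stripped form)
  have hsw' : ∀ x ∈ Set.Icc x₁ x₄, a j₀ 0 < (-(a j₀ 1)) * x ^ (e₁ + 1) + (-(a j₀ 2)) * x ^ (e₁ + e₂ + 2) := by
    intro x hx
    have hx0 : 0 < x := h0.trans_le hx.1
    have h := hsw x hx
    rw [hev] at h
    have hfac : a j₀ 0 * x ^ (d 0) + a j₀ 1 * x ^ (d 0 + (e₁ + 1)) + a j₀ 2 * x ^ (d 0 + (e₁ + e₂ + 2))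
        = x ^ (d 0) * (a j₀ 0 + a j₀ 1 * x ^ (e₁ + 1) + a j₀ 2 * x ^ (e₁ + e₂ + 2)) := by ring
    rw [hfac] at h
    have hxd : 0 < x ^ (d 0) := pow_pos hx0 _
    have := (mul_neg_iff.1 h).resolve_right (fun h' => absurd hxd (not_lt.2 h'.1.le))
    linarith [this.2]
  -- pullers unswitched on the whole interval (their stripped part is antitone in `x`)
  have hp' : ∀ x ∈ Set.Icc x₁ x₄, ∀ j, j ≠ j₀ →
      0 < a j 0 - (-(a j 1)) * x ^ (e₁ + 1) - (-(a j 2)) * x ^ (e₁ + e₂ + 2) := by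
    intro x hx j hj
    have hx0 : 0 < x := h0.trans_le hx.1
    obtain ⟨_, h1, h2, _⟩ := hpul j hj
    have h := hun j hj
    rw [hev] at h
    have hfac : a j 0 * x₄ ^ (d 0) + a j 1 * x₄ ^ (d 0 + (e₁ + 1)) + a j 2 * x₄ ^ (d 0 + (e₁ + e₂ + 2))
        = x₄ ^ (d 0) * (a j 0 + a j 1 * x₄ ^ (e₁ + 1) + a j 2 * x₄ ^ (e₁ + e₂ + 2)) := by ring
    rw [hfac] at h
    have hx4 : 0 < x₄ ^ (d 0) := pow_pos (h0.trans h14) _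
    have h4 : 0 < a j 0 + a j 1 * x₄ ^ (e₁ + 1) + a j 2 * x₄ ^ (e₁ + e₂ + 2) := (mul_pos_iff_of_pos_left hx4).1 h
    have hm1 : a j 1 * x₄ ^ (e₁ + 1) ≤ a j 1 * x ^ (e₁ + 1) :=
      mul_le_mul_of_nonpos_left (pow_le_pow_left₀ hx0.le hx.2 _) h1
    have hm2 : a j 2 * x₄ ^ (e₁ + e₂ + 2) ≤ a j 2 * x ^ (e₁ + e₂ + 2) :=
      mul_le_mul_of_nonpos_left (pow_le_pow_left₀ hx0.le hx.2 _) h2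
    linarith
  -- no factor vanishes on the interval
  have hf : ∀ x ∈ Set.Icc x₁ x₄, ∀ j, (∑ l, C (a j l) * X ^ (d l) : ℝ[X]).eval x ≠ 0 := by
    intro x hx j
    by_cases hj : j = j₀
    · subst hj; exact (hsw x hx).ne
    · have hx0 : 0 < x := h0.trans_le hx.1
      rw [hev]
      have hfac : a j 0 * x ^ (d 0) + a j 1 * x ^ (d 0 + (e₁ + 1)) + a j 2 * x ^ (d 0 + (e₁ + e₂ + 2))
          = x ^ (d 0) * (a j 0 + a j 1 * x ^ (e₁ + 1) + a j 2 * x ^ (e₁ + e₂ + 2)) := by ring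
      rw [hfac]
      refine mul_ne_zero (pow_ne_zero _ hx0.ne') (ne_of_gt ?_)
      have := hp' x hx j hj; linarith
  have hr' : ∀ x ∈ Set.Icc x₁ x₄, a j₀ 0 + a j₀ 1 * x ^ (e₁ + 1) + a j₀ 2 * x ^ (e₁ + e₂ + 2) ≠ 0 := by
    intro x hx; have := hsw' x hx; linarith
  have hpne : ∀ x ∈ Set.Icc x₁ x₄, ∀ j, j ≠ j₀ → a j 0 + a j 1 * x ^ (e₁ + 1) + a j 2 * x ^ (e₁ + e₂ + 2) ≠ 0 := by
    intro x hx j hj; have := hp' x hx j hj; linarith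
  -- the total Euler ratio vanishes at the four points
  have hzero' : ∀ x ∈ ({x₁, x₂, x₃, x₄} : Set ℝ),
      (((e₁ : ℝ) + 1) * (-(a j₀ 1)) * x ^ (e₁ + 1) + ((e₁ : ℝ) + e₂ + 2) * (-(a j₀ 2)) * x ^ (e₁ + e₂ + 2))
          / ((-(a j₀ 1)) * x ^ (e₁ + 1) + (-(a j₀ 2)) * x ^ (e₁ + e₂ + 2) - a j₀ 0)
        - cloudP0 e₁ e₂ (Finset.univ.erase j₀) (fun _ => (1 : ℝ)) (fun j => a j 0) (fun j => -(a j 1)) (fun j => -(a j 2)) x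
          = 0 := by
    intro x hx
    have hxI := hIcc x hx
    have hx0 : 0 < x := h0.trans_le hxI.1
    rw [← oneRiser_trinomial_eulerSum_eq d e₁ e₂ he₁ he₂ a j₀ hx0 (hr' x hxI) (hpne x hxI)]
    have h := hzero x hx
    rw [eval_eulerNumerator_eq_prod_mul_sum d a 0 (hf x hxI)] at h
    exact (mul_eq_zero.1 h).resolve_left (Finset.prod_ne_zero_iff.2 fun j _ => hf x hxI j)
  -- with or without pullers
  rcases (Finset.univ.erase j₀).eq_empty_or_nonempty with hs | hs
  · have h := hzero' x₁ (by simp)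
    rw [hs] at h
    simp only [cloudP0, Finset.sum_empty, sub_zero] at h
    have hden : 0 < (-(a j₀ 1)) * x₁ ^ (e₁ + 1) + (-(a j₀ 2)) * x₁ ^ (e₁ + e₂ + 2) - a j₀ 0 := by
      linarith [hsw' x₁ ⟨le_rfl, h14.le⟩]
    have hnum : 0 < ((e₁ : ℝ) + 1) * (-(a j₀ 1)) * x₁ ^ (e₁ + 1) + ((e₁ : ℝ) + e₂ + 2) * (-(a j₀ 2)) * x₁ ^ (e₁ + e₂ + 2) := by
      have hb : 0 < -(a j₀ 1) := by linarith
      have hc : 0 < -(a j₀ 2) := by linarith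
      positivity
    exact absurd h (div_pos hnum hden).ne'
  · exact oneRiser_no_four_zeros_trinomialCloud e₁ e₂ (b := -(a j₀ 1)) (c := -(a j₀ 2)) (by linarith) (by linarith)
      (Finset.univ.erase j₀) hs (fun _ => (1 : ℝ)) (fun j => a j 0) (fun j => -(a j 1)) (fun j => -(a j 2))
      (fun _ _ => one_pos) (fun j hj => by have := (hpul j (Finset.ne_of_mem_erase hj)).2.1; linarith)
      (fun j hj => by have := (hpul j (Finset.ne_of_mem_erase hj)).2.2.1; linarith)
      (fun j hj => by have := (hpul j (Finset.ne_of_mem_erase hj)).2.2.2; linarith)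
      h0 h12' h23 h34 hsw' (fun x hx j hj => hp' x hx j (Finset.ne_of_mem_erase hj)) hzero'

/-- ★ **One ONE-SIGNED trinomial row against any incoherent cloud** — instance of the previous theorem: a row `(−,−,−)` (= `(+,+,+)` up to
`R ↦ −R`) is «switched» at every `x > 0`, so on `(0, x₄]` with every other row an incoherent puller unswitched at `x₄` the c-free Euler
numerator has at most three zeros: the one-signed row's «0 → p → q double rise» costs at most one extra pair, whatever the cloud. -/
theorem oneSigned_trinomialCloud_eulerNumerator_no_four_zeros {m : ℕ} (d : Fin 3 → ℕ) (h01 : d 0 < d 1) (h12 : d 1 < d 2)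
    (a : Fin m → Fin 3 → ℝ) (j₀ : Fin m) (hr0 : a j₀ 0 < 0) (hr1 : a j₀ 1 < 0) (hr2 : a j₀ 2 < 0)
    (hpul : ∀ j, j ≠ j₀ → 0 < a j 0 ∧ a j 1 ≤ 0 ∧ a j 2 ≤ 0 ∧ a j 1 + a j 2 < 0)
    {x₁ x₂ x₃ x₄ : ℝ} (h0 : 0 < x₁) (h12' : x₁ < x₂) (h23 : x₂ < x₃) (h34 : x₃ < x₄)
    (hun : ∀ j, j ≠ j₀ → 0 < (∑ l, C (a j l) * X ^ (d l) : ℝ[X]).eval x₄)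
    (hzero : ∀ x ∈ ({x₁, x₂, x₃, x₄} : Set ℝ),
      (∑ j, (∑ l, C (a j l * ((d l : ℝ) - d 0)) * X ^ (d l)) * ∏ i ∈ Finset.univ.erase j, (∑ l, C (a i l) * X ^ (d l))
        : ℝ[X]).eval x = 0) : False := by
  refine oneRiser_trinomialCloud_eulerNumerator_no_four_zeros d h01 h12 a j₀ hr1 hr2 hpul h0 h12' h23 h34 (fun x hx => ?_) hun hzero
  have hx0 : 0 < x := h0.trans_le hx.1
  rw [eval_finsetSum]
  refine Finset.sum_neg (fun l _ => ?_) Finset.univ_nonempty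
  rw [eval_mul, eval_C, eval_pow, eval_X]
  have hal : a j₀ l < 0 := by fin_cases l <;> assumption
  exact mul_neg_of_neg_of_pos hal (pow_pos hx0 _)

end ProductPlusOne

end Summit.ValiantsHypothesis.ValiantsHypothesis.Theorems.LacunarySymmetroidMatrixDescartes
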